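import Literature.AlgebraicGeometry.Frobenioids.MotivatingExamplesSubProofs
import Literature.AlgebraicGeometry.Frobenioids.ArithmeticRealificationDegree
import HarnessLib

/-!
# Frobenioids I, §6 sub-DAG (S3): the composition row of Theorem 6.4 (ii) closed by name — PROOF (one-liner)

Mochizuki, *The geometry of Frobenioids I: the general theory*, Kyushu J. Math. **62** (2008) 293–400,
Theorem 6.4 (ii), kurims text p. 114; proof p. 115 l. 34 – p. 116 l. 3. [cite: MochizukiFrdI2008, Thm. 6.4 (ii) p.114]

PROOF-ONLY (seat abc-iut-L6-t10 gen 2, S3 holder): abc-iut-L1-t1's composition slot `Thm64ii_of_orderCompat`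
(`MotivatingExamplesSub.lean`: T64ii/L02 order-compatibility + T64ii/L04 uniformity ⟹ abc-iut-L1-t3's `Thm64ii`)
is DISCHARGED for all parameters by `Thm64ii_of_monotone` (`ArithmeticRealificationDegree.lean`, p411705) at
abc-iut-L1-t1's PROVED classical step T64ii/L03 `Thm64ii_L03_monotoneAddAut_holds` (an order-preserving additive
bijection of `ℝ` is `x ↦ c · x`, `c > 0`; `MotivatingExamplesSubProofs.lean`, p411524).
No definitions; nothing here bears on [IUTchIII] or asserts anything about abc.
-/

noncomputable section

namespace Literature.AlgebraicGeometry.Frobenioids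

open CategoryTheory

universe u v

variable {F₁ : Type} [Field F₁] {K₁ : Type} [Field K₁] [Algebra F₁ K₁]
variable {F₂ : Type} [Field F₂] {K₂ : Type} [Field K₂] [Algebra F₂ K₂]
variable {Rlf₁ : Type u} [Category.{v} Rlf₁] {Rlf₂ : Type u} [Category.{v} Rlf₂]
variable (R₁ : ArithRealification (F := F₁) (K := K₁) Rlf₁) (R₂ : ArithRealification (F := F₂) (K := K₂) Rlf₂)

/-- **T64ii/L02 + L04 ⟹ Thm. 6.4 (ii)** — abc-iut-L1-t1's composition slot `Thm64ii_of_orderCompat` HOLDS for every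
`R₁`, `R₂`, `Ψ`, `picMap` (FrdI p. 114; proof p. 115 l. 34 – p. 116 l. 3). [cite: MochizukiFrdI2008, Thm. 6.4 (ii) p.114] -/
theorem Thm64ii_of_orderCompat_holds (Ψ : Rlf₁ ≌ Rlf₂)
    (picMap : ∀ A : Rlf₁, R₁.Pic A ≃+ R₂.Pic (Ψ.functor.obj A)) :
    Thm64ii_of_orderCompat R₁ R₂ Ψ picMap := fun hmono hunif =>
  Thm64ii_of_monotone R₁ R₂ Thm64ii_L03_monotoneAddAut_holds Ψ picMap hmono hunif

end Literature.AlgebraicGeometry.Frobenioids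

end
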